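import Summits.BirchSwinnertonDyer.BirchSwinnertonDyer.Theorems.KatoDescentPotSupersingularWildUpperUnitTwistRecordsClassO607
import Summits.BirchSwinnertonDyer.BirchSwinnertonDyer.Theorems.KatoDescentPotSupersingularWildUpperUnitTwistRecordsFlat18
import Summits.BirchSwinnertonDyer.BirchSwinnertonDyer.Theorems.KatoDescentPotSupersingularWildUpperUnitTwistRecordsFlat19
import Summits.BirchSwinnertonDyer.BirchSwinnertonDyer.Theorems.KatoDescentPotSupersingularWildUpperUnitTwistRecordsFlat20
import Summits.BirchSwinnertonDyer.BirchSwinnertonDyer.Theorems.KatoDescentPotSupersingularWildUpperUnitTwistRecordsFlat21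
import Summits.BirchSwinnertonDyer.BirchSwinnertonDyer.Theorems.KatoDescentPotSupersingularWildUpperUnitTwistRecordsFlat60
import Summits.BirchSwinnertonDyer.BirchSwinnertonDyer.Theorems.KatoDescentPotSupersingularWildUpperUnitTwistRecordsSharp13
import Summits.BirchSwinnertonDyer.BirchSwinnertonDyer.Theorems.KatoDescentPotSupersingularWildFineSelmerSupersingularCMAnchor
import Summits.BirchSwinnertonDyer.BirchSwinnertonDyer.Theorems.KatoDescentPotSupersingularWildUpperDivisionFieldFukudaDoor
import Literature.NumberTheory.EllipticCurves.FineSelmerIsotypicClassGroupCriterion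
import HarnessLib

/-!
# Route `KatoDescentPotSupersingular` (rung K9, sub-rung B5 = O6 wild `p = 3`, cell `bsd-potss`): per-row records on the FACT-FREE door L6
# (class-number form) — statement (A) of Coates–Sujatha at `(E, 3)` with NO named fact, and U₀ modulo `hKatoA hGZK hmod`, for K9 U₀-ns rows that had
# NO fact-free (A) record so far, part 06 of 10: 202554u1, 209088cf1, 209088cg1, 209088cu1, 209088da1, 209088do1
# (seat `bsd-potss-k9-c4` g24; same road as this seat's door file `…WildFineSelmerClassNumberL6Door` (p697251), inlined: one call of conjA-anchor
# g16/g17's kernel door L6 `CoatesSujatha2005.conjA_of_not_dvd_card_classGroup` per row; `--supports stmt-BirchSwinnertonDyer-19197 --as helper`)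

HONEST FRAMING. THEOREMS ONLY (no definition, no named fact, no `sorry`); PER ROW — NOT a class theorem; nothing is booked; items 19189 / 19197 /
19942 / 19386 stay OPEN at class level (class-wide open input of record: the zeta crux 24327); Conjecture A and BSD are proved for NO class of
curves.  ROAD (door L6 of conjA-anchor g15 §9, KERNEL since g16/g17 2026-08-29): `E[3]` irreducible (kernel `irr_g…_3`), `Δ(E)` a CUBE
(kernel `Δ_cube_g…` here ⟹ `ρ̄₃` not onto ⟹ `3 ∤ #Gal(ℚ(E[3])/ℚ)`), `3 ∤ h(ℚ(E[3]))` (DISPLAYED integer `hh`; the class number is quoted per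
row from k9-c4 g7's census kit j265757 — PARI `bnfinit` of the degree-16 (`3Nn`) / degree-8 (`3Ns`) field `ℚ(E[3])`, `bnfcertify`'d where
marked CERT, else GRH — and conjA-anchor g15–g17's re-certification kit j313521/j316482), and `E(ℚ₃)[3] = 0` (DISPLAYED `hc3` in the
`E[3^∞]`-currency of the Deo–Ray–Sujatha facts: no non-zero point of `E[3^∞]` killed by `3` is fixed by the decomposition group at `3`; numerically
`#E(ℚ₃)[3] = 1` = column `t3` of kit j265757, division-polynomial Hensel test) ⟹ (A) at `(E,3)` for every cyclotomic `ℤ₃`-extension — NO NAMED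
FACT (`conjA_g…_3_L6`); and U₀ `MissingUpperBoundAt E 3` modulo `hKatoA hGZK hmod` + Cremona's `r_an = 0` (`missingUpperBoundAt_g…_3_L6`).
NOTHING is assumed at the bad places `v ≠ 3` (door L6 ≠ Deo–Ray–Sujatha's printed (c3)), so ♯ rows (`3 ∣ Tam`) are served.  SCOPE: conjA-anchor
g15's L6 census × k9-c4 g7: 228 K9 rows qualify; 167 already hold k8t-c4 g21's fact-free Iwasawa-1956 records (`…ClassNumberRecordsNoCS01–21`,
one prime above 3); these files record the OTHER 61 (54 `3Ns` + 7 `3Nn`; 19942 residue rows among them: 100386bx1, 155142bf1, 483678bi1).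
KERNEL lemmas `isElliptic_g…`, `isGloballyMinimal_g…`, `irr_g…_3`, `classO6_g…_3` are IMPORTED (k9-c4 g16–g18 / k8t-c4 g15 files, namespace
`…Theorems.WildUpperUnitTwistRecords`).

References: [CoatesSujatha2005] Thm. 3.4, Lemma 3.8; [DeoRaySujatha2023] Thm. 3.8/3.9 (b) (arXiv:2202.09937 pp. 9–10); [Washington1997] §13.3,
Thm. 10.4; [Serre1972] §2.4 Prop. 15, §5.3; [Kato2004Asterisque] Thm. 14.5 (3), Prop. 14.16 (2); [Cremona2006] Table 1.
-/

set_option autoImplicit false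
set_option linter.dupNamespace false

noncomputable section

open scoped Classical NumberField
open WeierstrassCurve NumberField Field IsDedekindDomain IntermediateField
  Literature.NumberTheory.EllipticCurves Literature.NumberTheory.EllipticCurves.Rank1Residual
  Literature.NumberTheory.EllipticCurves.Rank1Residual.Typed
  Literature.NumberTheory.GaloisRepresentations Literature.NumberTheory.SerreUniformity Literature.NumberTheory.IwasawaTheory
  Summit.BirchSwinnertonDyer.Rank1Residual Summit.BirchSwinnertonDyer.Rank1Residual.Additive
  Summit.BirchSwinnertonDyer.BirchSwinnertonDyer.Theorems
  Summit.BirchSwinnertonDyer.BirchSwinnertonDyer.Theorems.WildUpperUnitTwistRecords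

namespace Summit.BirchSwinnertonDyer.BirchSwinnertonDyer.Theorems.WildFineSelmerClassNumberL6Records

/-! ### `202554u1` @ `p = 3` — `N = 202554`; Cremona: `r_an = 0`; O6 wild at `3`; image `3Ns` (census); `ℚ(E[3])` of degree `8`: `h = 1` (GRH; `3 ∤ h`);
`#E(ℚ₃)[3] = 1` (kit j265757); bad places `2:3;11:1;31:1`. First fact-free (A) record for this row. -/

/-- `Δ(202554u1) = (73656)³` — a CUBE (kernel, `norm_num`). [cite: Serre1972, §5.3] [cite: Cremona2006, Table 1 (Cremona label 202554u1)] -/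
theorem Δ_cube_g202554u1 : (⟨1, (-1), 1, (-43121), 3320353⟩ : WeierstrassCurve ℚ).Δ = ((73656 : ℚ)) ^ 3 := by
  norm_num [WeierstrassCurve.Δ, WeierstrassCurve.b₂, WeierstrassCurve.b₄, WeierstrassCurve.b₆, WeierstrassCurve.b₈]

/-- **(A) AT `(202554u1, 3)` — NO NAMED FACT.**  Statement (A) of Coates–Sujatha for THIS curve at `p = 3` (the dual fine Selmer group over
`ℚ_cyc` is finitely generated over `ℤ₃`, every cyclotomic `ℤ₃`-extension), by door L6 (class-number form): KERNEL `irr_g202554u1_3`, `Δ_cube_g202554u1`;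
DISPLAYED `hh` (`3 ∤ h(ℚ(E[3])) = 1`, GRH) and `hc3` (`E(ℚ₃)[3] = 0`; `t3 = 1`, kit j265757). Per row; nothing booked.
[cite: CoatesSujatha2005, §3 Thm. 3.4 and Lemma 3.8] [cite: DeoRaySujatha2023, §3 Thm. 3.9 (b) (arXiv:2202.09937 p. 10)]
[cite: Serre1972, §2.4 Prop. 15, §5.3] [cite: Cremona2006, Table 1 (Cremona label 202554u1)] -/
theorem conjA_g202554u1_3_L6
    {W : WeierstrassCurve ℚ} [W.IsElliptic] (hWeq : W = (⟨1, (-1), 1, (-43121), 3320353⟩ : WeierstrassCurve ℚ))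
    (hh : haveI : NumberField ↥(W.divisionField 3) := NumberField.mk
      ¬ 3 ∣ NumberField.classNumber ↥(W.divisionField 3))
    (hc3 : ∀ v : HeightOneSpectrum (𝓞 ℚ), ((3 : ℕ) : 𝓞 ℚ) ∈ v.asIdeal →
      ∀ x : W.geomPrimaryTorsion 3, 3 • x = 0 → (∀ δ ∈ GreenbergSelmer.decomp v, δ • x = x) → x = 0)
    (κ : ZpExtension ℚ 3) (hκ : κ.IsCyclotomic) :
    ∃ (γ : absoluteGaloisGroup ℚ) (Df : W.FineSelmerDualData κ γ),
      Module.Finite ℤ_[3] (RestrictScalars ℤ_[3] (IwasawaAlgebra 3) Df.X) := by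
  subst hWeq
  haveI : Fact (Nat.Prime 3) := ⟨Nat.prime_three⟩
  haveI : NumberField ↥((⟨1, (-1), 1, (-43121), 3320353⟩ : WeierstrassCurve ℚ).divisionField 3) := NumberField.mk
  exact CoatesSujatha2005.conjA_of_not_dvd_card_classGroup _ (by decide)
    (DivisionFieldFukudaDoor.not_dvd_card_aut_divisionField_three_of_Δ_eq_cube _ irr_g202554u1_3 Δ_cube_g202554u1)
    (by rw [Nat.card_eq_fintype_card]; exact hh) hκ hc3

/-- **RECORD — U₀ `ord₃ #Ш(E) ≤ ord₃ #Ш(E)_an` for `E = 202554u1` at `p = 3` on the fact-free door L6** (U₀-ns row of K9 items 19189 / 19197):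
KERNEL `classO6_g202554u1_3`, `irr_g202554u1_3`, `Δ_cube_g202554u1`; DISPLAYED named facts `hKatoA hGZK hmod` ONLY, Cremona's `r_an = 0` (`hr`), and the two
numerics `hh` (`h(ℚ(E[3])) = 1`, GRH) / `hc3` (`#E(ℚ₃)[3] = 1`). Per row; nothing booked; BSD is not proved by this.
[cite: Kato2004Asterisque, Thm. 14.5 (3) (p. 236) and Prop. 14.16 (2)] [cite: CoatesSujatha2005, §3 Thm. 3.4]
[cite: DeoRaySujatha2023, §3 Thm. 3.9 (b)] [cite: Cremona2006, Table 1 (Cremona label 202554u1)] -/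
theorem missingUpperBoundAt_g202554u1_3_L6
    (hKatoA : Kato2004.rankZero_padicValNat_sha_add_padicValNat_tamagawa_le_of_additive_potGood_of_irreducible_of_fineSelmerDual_fg)
    (hGZK : rank_eq_analyticRank_of_analyticRank_le_one) (hmod : hasEntireLFunction_rat)
    {W : WeierstrassCurve ℚ} [W.IsElliptic] [W.IsGloballyMinimal] (hWeq : W = (⟨1, (-1), 1, (-43121), 3320353⟩ : WeierstrassCurve ℚ)) (hr : W.analyticRank = 0)
    (hh : haveI : NumberField ↥(W.divisionField 3) := NumberField.mk
      ¬ 3 ∣ NumberField.classNumber ↥(W.divisionField 3))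
    (hc3 : ∀ v : HeightOneSpectrum (𝓞 ℚ), ((3 : ℕ) : 𝓞 ℚ) ∈ v.asIdeal →
      ∀ x : W.geomPrimaryTorsion 3, 3 • x = 0 → (∀ δ ∈ GreenbergSelmer.decomp v, δ • x = x) → x = 0) :
    MissingUpperBoundAt W 3 := by
  subst hWeq
  haveI : Fact (Nat.Prime 3) := ⟨Nat.prime_three⟩
  exact WildFineSelmerSupersingularCMAnchor.missingUpperBoundAt_wild_of_conjA hKatoA hGZK hmod _ hr classO6_g202554u1_3 irr_g202554u1_3
    (fun κ hκ => conjA_g202554u1_3_L6 rfl hh hc3 κ hκ)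

/-! ### `209088cf1` @ `p = 3` — `N = 209088`; Cremona: `r_an = 0`; O6 wild at `3`; image `3Ns` (census); `ℚ(E[3])` of degree `8`: `h = 8` (CERT; `3 ∤ h`);
`#E(ℚ₃)[3] = 1` (kit j265757); bad places `2:1;11:1`. First fact-free (A) record for this row. -/

/-- `Δ(209088cf1) = ((-4599936))³` — a CUBE (kernel, `norm_num`). [cite: Serre1972, §5.3] [cite: Cremona2006, Table 1 (Cremona label 209088cf1)] -/
theorem Δ_cube_g209088cf1 : (⟨0, 0, 0, (-431244), (-487018224)⟩ : WeierstrassCurve ℚ).Δ = (((-4599936) : ℚ)) ^ 3 := by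
  norm_num [WeierstrassCurve.Δ, WeierstrassCurve.b₂, WeierstrassCurve.b₄, WeierstrassCurve.b₆, WeierstrassCurve.b₈]

/-- **(A) AT `(209088cf1, 3)` — NO NAMED FACT.**  Statement (A) of Coates–Sujatha for THIS curve at `p = 3` (the dual fine Selmer group over
`ℚ_cyc` is finitely generated over `ℤ₃`, every cyclotomic `ℤ₃`-extension), by door L6 (class-number form): KERNEL `irr_g209088cf1_3`, `Δ_cube_g209088cf1`;
DISPLAYED `hh` (`3 ∤ h(ℚ(E[3])) = 8`, CERT) and `hc3` (`E(ℚ₃)[3] = 0`; `t3 = 1`, kit j265757). Per row; nothing booked.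
[cite: CoatesSujatha2005, §3 Thm. 3.4 and Lemma 3.8] [cite: DeoRaySujatha2023, §3 Thm. 3.9 (b) (arXiv:2202.09937 p. 10)]
[cite: Serre1972, §2.4 Prop. 15, §5.3] [cite: Cremona2006, Table 1 (Cremona label 209088cf1)] -/
theorem conjA_g209088cf1_3_L6
    {W : WeierstrassCurve ℚ} [W.IsElliptic] (hWeq : W = (⟨0, 0, 0, (-431244), (-487018224)⟩ : WeierstrassCurve ℚ))
    (hh : haveI : NumberField ↥(W.divisionField 3) := NumberField.mk
      ¬ 3 ∣ NumberField.classNumber ↥(W.divisionField 3))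
    (hc3 : ∀ v : HeightOneSpectrum (𝓞 ℚ), ((3 : ℕ) : 𝓞 ℚ) ∈ v.asIdeal →
      ∀ x : W.geomPrimaryTorsion 3, 3 • x = 0 → (∀ δ ∈ GreenbergSelmer.decomp v, δ • x = x) → x = 0)
    (κ : ZpExtension ℚ 3) (hκ : κ.IsCyclotomic) :
    ∃ (γ : absoluteGaloisGroup ℚ) (Df : W.FineSelmerDualData κ γ),
      Module.Finite ℤ_[3] (RestrictScalars ℤ_[3] (IwasawaAlgebra 3) Df.X) := by
  subst hWeq
  haveI : Fact (Nat.Prime 3) := ⟨Nat.prime_three⟩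
  haveI : NumberField ↥((⟨0, 0, 0, (-431244), (-487018224)⟩ : WeierstrassCurve ℚ).divisionField 3) := NumberField.mk
  exact CoatesSujatha2005.conjA_of_not_dvd_card_classGroup _ (by decide)
    (DivisionFieldFukudaDoor.not_dvd_card_aut_divisionField_three_of_Δ_eq_cube _ irr_g209088cf1_3 Δ_cube_g209088cf1)
    (by rw [Nat.card_eq_fintype_card]; exact hh) hκ hc3

/-- **RECORD — U₀ `ord₃ #Ш(E) ≤ ord₃ #Ш(E)_an` for `E = 209088cf1` at `p = 3` on the fact-free door L6** (U₀-ns row of K9 items 19189 / 19197):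
KERNEL `classO6_g209088cf1_3`, `irr_g209088cf1_3`, `Δ_cube_g209088cf1`; DISPLAYED named facts `hKatoA hGZK hmod` ONLY, Cremona's `r_an = 0` (`hr`), and the two
numerics `hh` (`h(ℚ(E[3])) = 8`, CERT) / `hc3` (`#E(ℚ₃)[3] = 1`). Per row; nothing booked; BSD is not proved by this.
[cite: Kato2004Asterisque, Thm. 14.5 (3) (p. 236) and Prop. 14.16 (2)] [cite: CoatesSujatha2005, §3 Thm. 3.4]
[cite: DeoRaySujatha2023, §3 Thm. 3.9 (b)] [cite: Cremona2006, Table 1 (Cremona label 209088cf1)] -/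
theorem missingUpperBoundAt_g209088cf1_3_L6
    (hKatoA : Kato2004.rankZero_padicValNat_sha_add_padicValNat_tamagawa_le_of_additive_potGood_of_irreducible_of_fineSelmerDual_fg)
    (hGZK : rank_eq_analyticRank_of_analyticRank_le_one) (hmod : hasEntireLFunction_rat)
    {W : WeierstrassCurve ℚ} [W.IsElliptic] [W.IsGloballyMinimal] (hWeq : W = (⟨0, 0, 0, (-431244), (-487018224)⟩ : WeierstrassCurve ℚ)) (hr : W.analyticRank = 0)
    (hh : haveI : NumberField ↥(W.divisionField 3) := NumberField.mk
      ¬ 3 ∣ NumberField.classNumber ↥(W.divisionField 3))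
    (hc3 : ∀ v : HeightOneSpectrum (𝓞 ℚ), ((3 : ℕ) : 𝓞 ℚ) ∈ v.asIdeal →
      ∀ x : W.geomPrimaryTorsion 3, 3 • x = 0 → (∀ δ ∈ GreenbergSelmer.decomp v, δ • x = x) → x = 0) :
    MissingUpperBoundAt W 3 := by
  subst hWeq
  haveI : Fact (Nat.Prime 3) := ⟨Nat.prime_three⟩
  exact WildFineSelmerSupersingularCMAnchor.missingUpperBoundAt_wild_of_conjA hKatoA hGZK hmod _ hr classO6_g209088cf1_3 irr_g209088cf1_3
    (fun κ hκ => conjA_g209088cf1_3_L6 rfl hh hc3 κ hκ)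

/-! ### `209088cg1` @ `p = 3` — `N = 209088`; Cremona: `r_an = 0`; O6 wild at `3`; image `3Ns` (census); `ℚ(E[3])` of degree `8`: `h = 8` (CERT; `3 ∤ h`);
`#E(ℚ₃)[3] = 1` (kit j265757); bad places `2:1;11:1`. First fact-free (A) record for this row. -/

/-- `Δ(209088cg1) = ((-38016))³` — a CUBE (kernel, `norm_num`). [cite: Serre1972, §5.3] [cite: Cremona2006, Table 1 (Cremona label 209088cg1)] -/
theorem Δ_cube_g209088cg1 : (⟨0, 0, 0, (-3564), 365904⟩ : WeierstrassCurve ℚ).Δ = (((-38016) : ℚ)) ^ 3 := by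
  norm_num [WeierstrassCurve.Δ, WeierstrassCurve.b₂, WeierstrassCurve.b₄, WeierstrassCurve.b₆, WeierstrassCurve.b₈]

/-- **(A) AT `(209088cg1, 3)` — NO NAMED FACT.**  Statement (A) of Coates–Sujatha for THIS curve at `p = 3` (the dual fine Selmer group over
`ℚ_cyc` is finitely generated over `ℤ₃`, every cyclotomic `ℤ₃`-extension), by door L6 (class-number form): KERNEL `irr_g209088cg1_3`, `Δ_cube_g209088cg1`;
DISPLAYED `hh` (`3 ∤ h(ℚ(E[3])) = 8`, CERT) and `hc3` (`E(ℚ₃)[3] = 0`; `t3 = 1`, kit j265757). Per row; nothing booked.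
[cite: CoatesSujatha2005, §3 Thm. 3.4 and Lemma 3.8] [cite: DeoRaySujatha2023, §3 Thm. 3.9 (b) (arXiv:2202.09937 p. 10)]
[cite: Serre1972, §2.4 Prop. 15, §5.3] [cite: Cremona2006, Table 1 (Cremona label 209088cg1)] -/
theorem conjA_g209088cg1_3_L6
    {W : WeierstrassCurve ℚ} [W.IsElliptic] (hWeq : W = (⟨0, 0, 0, (-3564), 365904⟩ : WeierstrassCurve ℚ))
    (hh : haveI : NumberField ↥(W.divisionField 3) := NumberField.mk
      ¬ 3 ∣ NumberField.classNumber ↥(W.divisionField 3))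
    (hc3 : ∀ v : HeightOneSpectrum (𝓞 ℚ), ((3 : ℕ) : 𝓞 ℚ) ∈ v.asIdeal →
      ∀ x : W.geomPrimaryTorsion 3, 3 • x = 0 → (∀ δ ∈ GreenbergSelmer.decomp v, δ • x = x) → x = 0)
    (κ : ZpExtension ℚ 3) (hκ : κ.IsCyclotomic) :
    ∃ (γ : absoluteGaloisGroup ℚ) (Df : W.FineSelmerDualData κ γ),
      Module.Finite ℤ_[3] (RestrictScalars ℤ_[3] (IwasawaAlgebra 3) Df.X) := by
  subst hWeq
  haveI : Fact (Nat.Prime 3) := ⟨Nat.prime_three⟩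
  haveI : NumberField ↥((⟨0, 0, 0, (-3564), 365904⟩ : WeierstrassCurve ℚ).divisionField 3) := NumberField.mk
  exact CoatesSujatha2005.conjA_of_not_dvd_card_classGroup _ (by decide)
    (DivisionFieldFukudaDoor.not_dvd_card_aut_divisionField_three_of_Δ_eq_cube _ irr_g209088cg1_3 Δ_cube_g209088cg1)
    (by rw [Nat.card_eq_fintype_card]; exact hh) hκ hc3

/-- **RECORD — U₀ `ord₃ #Ш(E) ≤ ord₃ #Ш(E)_an` for `E = 209088cg1` at `p = 3` on the fact-free door L6** (U₀-ns row of K9 items 19189 / 19197):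
KERNEL `classO6_g209088cg1_3`, `irr_g209088cg1_3`, `Δ_cube_g209088cg1`; DISPLAYED named facts `hKatoA hGZK hmod` ONLY, Cremona's `r_an = 0` (`hr`), and the two
numerics `hh` (`h(ℚ(E[3])) = 8`, CERT) / `hc3` (`#E(ℚ₃)[3] = 1`). Per row; nothing booked; BSD is not proved by this.
[cite: Kato2004Asterisque, Thm. 14.5 (3) (p. 236) and Prop. 14.16 (2)] [cite: CoatesSujatha2005, §3 Thm. 3.4]
[cite: DeoRaySujatha2023, §3 Thm. 3.9 (b)] [cite: Cremona2006, Table 1 (Cremona label 209088cg1)] -/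
theorem missingUpperBoundAt_g209088cg1_3_L6
    (hKatoA : Kato2004.rankZero_padicValNat_sha_add_padicValNat_tamagawa_le_of_additive_potGood_of_irreducible_of_fineSelmerDual_fg)
    (hGZK : rank_eq_analyticRank_of_analyticRank_le_one) (hmod : hasEntireLFunction_rat)
    {W : WeierstrassCurve ℚ} [W.IsElliptic] [W.IsGloballyMinimal] (hWeq : W = (⟨0, 0, 0, (-3564), 365904⟩ : WeierstrassCurve ℚ)) (hr : W.analyticRank = 0)
    (hh : haveI : NumberField ↥(W.divisionField 3) := NumberField.mk
      ¬ 3 ∣ NumberField.classNumber ↥(W.divisionField 3))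
    (hc3 : ∀ v : HeightOneSpectrum (𝓞 ℚ), ((3 : ℕ) : 𝓞 ℚ) ∈ v.asIdeal →
      ∀ x : W.geomPrimaryTorsion 3, 3 • x = 0 → (∀ δ ∈ GreenbergSelmer.decomp v, δ • x = x) → x = 0) :
    MissingUpperBoundAt W 3 := by
  subst hWeq
  haveI : Fact (Nat.Prime 3) := ⟨Nat.prime_three⟩
  exact WildFineSelmerSupersingularCMAnchor.missingUpperBoundAt_wild_of_conjA hKatoA hGZK hmod _ hr classO6_g209088cg1_3 irr_g209088cg1_3
    (fun κ hκ => conjA_g209088cg1_3_L6 rfl hh hc3 κ hκ)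

/-! ### `209088cu1` @ `p = 3` — `N = 209088`; Cremona: `r_an = 0`; O6 wild at `3`; image `3Ns` (census); `ℚ(E[3])` of degree `8`: `h = 8` (CERT; `3 ∤ h`);
`#E(ℚ₃)[3] = 1` (kit j265757); bad places `2:1;11:1`. First fact-free (A) record for this row. -/

/-- `Δ(209088cu1) = ((-9199872))³` — a CUBE (kernel, `norm_num`). [cite: Serre1972, §5.3] [cite: Cremona2006, Table 1 (Cremona label 209088cu1)] -/
theorem Δ_cube_g209088cu1 : (⟨0, 0, 0, 718740, (-1321906608)⟩ : WeierstrassCurve ℚ).Δ = (((-9199872) : ℚ)) ^ 3 := by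
  norm_num [WeierstrassCurve.Δ, WeierstrassCurve.b₂, WeierstrassCurve.b₄, WeierstrassCurve.b₆, WeierstrassCurve.b₈]

/-- **(A) AT `(209088cu1, 3)` — NO NAMED FACT.**  Statement (A) of Coates–Sujatha for THIS curve at `p = 3` (the dual fine Selmer group over
`ℚ_cyc` is finitely generated over `ℤ₃`, every cyclotomic `ℤ₃`-extension), by door L6 (class-number form): KERNEL `irr_g209088cu1_3`, `Δ_cube_g209088cu1`;
DISPLAYED `hh` (`3 ∤ h(ℚ(E[3])) = 8`, CERT) and `hc3` (`E(ℚ₃)[3] = 0`; `t3 = 1`, kit j265757). Per row; nothing booked.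
[cite: CoatesSujatha2005, §3 Thm. 3.4 and Lemma 3.8] [cite: DeoRaySujatha2023, §3 Thm. 3.9 (b) (arXiv:2202.09937 p. 10)]
[cite: Serre1972, §2.4 Prop. 15, §5.3] [cite: Cremona2006, Table 1 (Cremona label 209088cu1)] -/
theorem conjA_g209088cu1_3_L6
    {W : WeierstrassCurve ℚ} [W.IsElliptic] (hWeq : W = (⟨0, 0, 0, 718740, (-1321906608)⟩ : WeierstrassCurve ℚ))
    (hh : haveI : NumberField ↥(W.divisionField 3) := NumberField.mk
      ¬ 3 ∣ NumberField.classNumber ↥(W.divisionField 3))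
    (hc3 : ∀ v : HeightOneSpectrum (𝓞 ℚ), ((3 : ℕ) : 𝓞 ℚ) ∈ v.asIdeal →
      ∀ x : W.geomPrimaryTorsion 3, 3 • x = 0 → (∀ δ ∈ GreenbergSelmer.decomp v, δ • x = x) → x = 0)
    (κ : ZpExtension ℚ 3) (hκ : κ.IsCyclotomic) :
    ∃ (γ : absoluteGaloisGroup ℚ) (Df : W.FineSelmerDualData κ γ),
      Module.Finite ℤ_[3] (RestrictScalars ℤ_[3] (IwasawaAlgebra 3) Df.X) := by
  subst hWeq
  haveI : Fact (Nat.Prime 3) := ⟨Nat.prime_three⟩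
  haveI : NumberField ↥((⟨0, 0, 0, 718740, (-1321906608)⟩ : WeierstrassCurve ℚ).divisionField 3) := NumberField.mk
  exact CoatesSujatha2005.conjA_of_not_dvd_card_classGroup _ (by decide)
    (DivisionFieldFukudaDoor.not_dvd_card_aut_divisionField_three_of_Δ_eq_cube _ irr_g209088cu1_3 Δ_cube_g209088cu1)
    (by rw [Nat.card_eq_fintype_card]; exact hh) hκ hc3

/-- **RECORD — U₀ `ord₃ #Ш(E) ≤ ord₃ #Ш(E)_an` for `E = 209088cu1` at `p = 3` on the fact-free door L6** (U₀-ns row of K9 items 19189 / 19197):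
KERNEL `classO6_g209088cu1_3`, `irr_g209088cu1_3`, `Δ_cube_g209088cu1`; DISPLAYED named facts `hKatoA hGZK hmod` ONLY, Cremona's `r_an = 0` (`hr`), and the two
numerics `hh` (`h(ℚ(E[3])) = 8`, CERT) / `hc3` (`#E(ℚ₃)[3] = 1`). Per row; nothing booked; BSD is not proved by this.
[cite: Kato2004Asterisque, Thm. 14.5 (3) (p. 236) and Prop. 14.16 (2)] [cite: CoatesSujatha2005, §3 Thm. 3.4]
[cite: DeoRaySujatha2023, §3 Thm. 3.9 (b)] [cite: Cremona2006, Table 1 (Cremona label 209088cu1)] -/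
theorem missingUpperBoundAt_g209088cu1_3_L6
    (hKatoA : Kato2004.rankZero_padicValNat_sha_add_padicValNat_tamagawa_le_of_additive_potGood_of_irreducible_of_fineSelmerDual_fg)
    (hGZK : rank_eq_analyticRank_of_analyticRank_le_one) (hmod : hasEntireLFunction_rat)
    {W : WeierstrassCurve ℚ} [W.IsElliptic] [W.IsGloballyMinimal] (hWeq : W = (⟨0, 0, 0, 718740, (-1321906608)⟩ : WeierstrassCurve ℚ)) (hr : W.analyticRank = 0)
    (hh : haveI : NumberField ↥(W.divisionField 3) := NumberField.mk
      ¬ 3 ∣ NumberField.classNumber ↥(W.divisionField 3))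
    (hc3 : ∀ v : HeightOneSpectrum (𝓞 ℚ), ((3 : ℕ) : 𝓞 ℚ) ∈ v.asIdeal →
      ∀ x : W.geomPrimaryTorsion 3, 3 • x = 0 → (∀ δ ∈ GreenbergSelmer.decomp v, δ • x = x) → x = 0) :
    MissingUpperBoundAt W 3 := by
  subst hWeq
  haveI : Fact (Nat.Prime 3) := ⟨Nat.prime_three⟩
  exact WildFineSelmerSupersingularCMAnchor.missingUpperBoundAt_wild_of_conjA hKatoA hGZK hmod _ hr classO6_g209088cu1_3 irr_g209088cu1_3
    (fun κ hκ => conjA_g209088cu1_3_L6 rfl hh hc3 κ hκ)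

/-! ### `209088da1` @ `p = 3` — `N = 209088`; Cremona: `r_an = 0`; O6 wild at `3`; image `3Ns` (census); `ℚ(E[3])` of degree `8`: `h = 8` (CERT; `3 ∤ h`);
`#E(ℚ₃)[3] = 1` (kit j265757); bad places `2:1;11:1`. First fact-free (A) record for this row. -/

/-- `Δ(209088da1) = ((-76032))³` — a CUBE (kernel, `norm_num`). [cite: Serre1972, §5.3] [cite: Cremona2006, Table 1 (Cremona label 209088da1)] -/
theorem Δ_cube_g209088da1 : (⟨0, 0, 0, 5940, 993168⟩ : WeierstrassCurve ℚ).Δ = (((-76032) : ℚ)) ^ 3 := by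
  norm_num [WeierstrassCurve.Δ, WeierstrassCurve.b₂, WeierstrassCurve.b₄, WeierstrassCurve.b₆, WeierstrassCurve.b₈]

/-- **(A) AT `(209088da1, 3)` — NO NAMED FACT.**  Statement (A) of Coates–Sujatha for THIS curve at `p = 3` (the dual fine Selmer group over
`ℚ_cyc` is finitely generated over `ℤ₃`, every cyclotomic `ℤ₃`-extension), by door L6 (class-number form): KERNEL `irr_g209088da1_3`, `Δ_cube_g209088da1`;
DISPLAYED `hh` (`3 ∤ h(ℚ(E[3])) = 8`, CERT) and `hc3` (`E(ℚ₃)[3] = 0`; `t3 = 1`, kit j265757). Per row; nothing booked.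
[cite: CoatesSujatha2005, §3 Thm. 3.4 and Lemma 3.8] [cite: DeoRaySujatha2023, §3 Thm. 3.9 (b) (arXiv:2202.09937 p. 10)]
[cite: Serre1972, §2.4 Prop. 15, §5.3] [cite: Cremona2006, Table 1 (Cremona label 209088da1)] -/
theorem conjA_g209088da1_3_L6
    {W : WeierstrassCurve ℚ} [W.IsElliptic] (hWeq : W = (⟨0, 0, 0, 5940, 993168⟩ : WeierstrassCurve ℚ))
    (hh : haveI : NumberField ↥(W.divisionField 3) := NumberField.mk
      ¬ 3 ∣ NumberField.classNumber ↥(W.divisionField 3))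
    (hc3 : ∀ v : HeightOneSpectrum (𝓞 ℚ), ((3 : ℕ) : 𝓞 ℚ) ∈ v.asIdeal →
      ∀ x : W.geomPrimaryTorsion 3, 3 • x = 0 → (∀ δ ∈ GreenbergSelmer.decomp v, δ • x = x) → x = 0)
    (κ : ZpExtension ℚ 3) (hκ : κ.IsCyclotomic) :
    ∃ (γ : absoluteGaloisGroup ℚ) (Df : W.FineSelmerDualData κ γ),
      Module.Finite ℤ_[3] (RestrictScalars ℤ_[3] (IwasawaAlgebra 3) Df.X) := by
  subst hWeq
  haveI : Fact (Nat.Prime 3) := ⟨Nat.prime_three⟩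
  haveI : NumberField ↥((⟨0, 0, 0, 5940, 993168⟩ : WeierstrassCurve ℚ).divisionField 3) := NumberField.mk
  exact CoatesSujatha2005.conjA_of_not_dvd_card_classGroup _ (by decide)
    (DivisionFieldFukudaDoor.not_dvd_card_aut_divisionField_three_of_Δ_eq_cube _ irr_g209088da1_3 Δ_cube_g209088da1)
    (by rw [Nat.card_eq_fintype_card]; exact hh) hκ hc3

/-- **RECORD — U₀ `ord₃ #Ш(E) ≤ ord₃ #Ш(E)_an` for `E = 209088da1` at `p = 3` on the fact-free door L6** (U₀-ns row of K9 items 19189 / 19197):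
KERNEL `classO6_g209088da1_3`, `irr_g209088da1_3`, `Δ_cube_g209088da1`; DISPLAYED named facts `hKatoA hGZK hmod` ONLY, Cremona's `r_an = 0` (`hr`), and the two
numerics `hh` (`h(ℚ(E[3])) = 8`, CERT) / `hc3` (`#E(ℚ₃)[3] = 1`). Per row; nothing booked; BSD is not proved by this.
[cite: Kato2004Asterisque, Thm. 14.5 (3) (p. 236) and Prop. 14.16 (2)] [cite: CoatesSujatha2005, §3 Thm. 3.4]
[cite: DeoRaySujatha2023, §3 Thm. 3.9 (b)] [cite: Cremona2006, Table 1 (Cremona label 209088da1)] -/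
theorem missingUpperBoundAt_g209088da1_3_L6
    (hKatoA : Kato2004.rankZero_padicValNat_sha_add_padicValNat_tamagawa_le_of_additive_potGood_of_irreducible_of_fineSelmerDual_fg)
    (hGZK : rank_eq_analyticRank_of_analyticRank_le_one) (hmod : hasEntireLFunction_rat)
    {W : WeierstrassCurve ℚ} [W.IsElliptic] [W.IsGloballyMinimal] (hWeq : W = (⟨0, 0, 0, 5940, 993168⟩ : WeierstrassCurve ℚ)) (hr : W.analyticRank = 0)
    (hh : haveI : NumberField ↥(W.divisionField 3) := NumberField.mk
      ¬ 3 ∣ NumberField.classNumber ↥(W.divisionField 3))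
    (hc3 : ∀ v : HeightOneSpectrum (𝓞 ℚ), ((3 : ℕ) : 𝓞 ℚ) ∈ v.asIdeal →
      ∀ x : W.geomPrimaryTorsion 3, 3 • x = 0 → (∀ δ ∈ GreenbergSelmer.decomp v, δ • x = x) → x = 0) :
    MissingUpperBoundAt W 3 := by
  subst hWeq
  haveI : Fact (Nat.Prime 3) := ⟨Nat.prime_three⟩
  exact WildFineSelmerSupersingularCMAnchor.missingUpperBoundAt_wild_of_conjA hKatoA hGZK hmod _ hr classO6_g209088da1_3 irr_g209088da1_3
    (fun κ hκ => conjA_g209088da1_3_L6 rfl hh hc3 κ hκ)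

/-! ### `209088do1` @ `p = 3` — `N = 209088`; Cremona: `r_an = 0`; O6 wild at `3`; image `3Ns` (census); `ℚ(E[3])` of degree `8`: `h = 8` (CERT; `3 ∤ h`);
`#E(ℚ₃)[3] = 1` (kit j265757); bad places `2:1;11:1`. First fact-free (A) record for this row. -/

/-- `Δ(209088do1) = ((-511104))³` — a CUBE (kernel, `norm_num`). [cite: Serre1972, §5.3] [cite: Cremona2006, Table 1 (Cremona label 209088do1)] -/
theorem Δ_cube_g209088do1 : (⟨0, 0, 0, (-47916), 18037712⟩ : WeierstrassCurve ℚ).Δ = (((-511104) : ℚ)) ^ 3 := by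
  norm_num [WeierstrassCurve.Δ, WeierstrassCurve.b₂, WeierstrassCurve.b₄, WeierstrassCurve.b₆, WeierstrassCurve.b₈]

/-- **(A) AT `(209088do1, 3)` — NO NAMED FACT.**  Statement (A) of Coates–Sujatha for THIS curve at `p = 3` (the dual fine Selmer group over
`ℚ_cyc` is finitely generated over `ℤ₃`, every cyclotomic `ℤ₃`-extension), by door L6 (class-number form): KERNEL `irr_g209088do1_3`, `Δ_cube_g209088do1`;
DISPLAYED `hh` (`3 ∤ h(ℚ(E[3])) = 8`, CERT) and `hc3` (`E(ℚ₃)[3] = 0`; `t3 = 1`, kit j265757). Per row; nothing booked.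
[cite: CoatesSujatha2005, §3 Thm. 3.4 and Lemma 3.8] [cite: DeoRaySujatha2023, §3 Thm. 3.9 (b) (arXiv:2202.09937 p. 10)]
[cite: Serre1972, §2.4 Prop. 15, §5.3] [cite: Cremona2006, Table 1 (Cremona label 209088do1)] -/
theorem conjA_g209088do1_3_L6
    {W : WeierstrassCurve ℚ} [W.IsElliptic] (hWeq : W = (⟨0, 0, 0, (-47916), 18037712⟩ : WeierstrassCurve ℚ))
    (hh : haveI : NumberField ↥(W.divisionField 3) := NumberField.mk
      ¬ 3 ∣ NumberField.classNumber ↥(W.divisionField 3))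
    (hc3 : ∀ v : HeightOneSpectrum (𝓞 ℚ), ((3 : ℕ) : 𝓞 ℚ) ∈ v.asIdeal →
      ∀ x : W.geomPrimaryTorsion 3, 3 • x = 0 → (∀ δ ∈ GreenbergSelmer.decomp v, δ • x = x) → x = 0)
    (κ : ZpExtension ℚ 3) (hκ : κ.IsCyclotomic) :
    ∃ (γ : absoluteGaloisGroup ℚ) (Df : W.FineSelmerDualData κ γ),
      Module.Finite ℤ_[3] (RestrictScalars ℤ_[3] (IwasawaAlgebra 3) Df.X) := by
  subst hWeq
  haveI : Fact (Nat.Prime 3) := ⟨Nat.prime_three⟩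
  haveI : NumberField ↥((⟨0, 0, 0, (-47916), 18037712⟩ : WeierstrassCurve ℚ).divisionField 3) := NumberField.mk
  exact CoatesSujatha2005.conjA_of_not_dvd_card_classGroup _ (by decide)
    (DivisionFieldFukudaDoor.not_dvd_card_aut_divisionField_three_of_Δ_eq_cube _ irr_g209088do1_3 Δ_cube_g209088do1)
    (by rw [Nat.card_eq_fintype_card]; exact hh) hκ hc3

/-- **RECORD — U₀ `ord₃ #Ш(E) ≤ ord₃ #Ш(E)_an` for `E = 209088do1` at `p = 3` on the fact-free door L6** (U₀-ns row of K9 items 19189 / 19197):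
KERNEL `classO6_g209088do1_3`, `irr_g209088do1_3`, `Δ_cube_g209088do1`; DISPLAYED named facts `hKatoA hGZK hmod` ONLY, Cremona's `r_an = 0` (`hr`), and the two
numerics `hh` (`h(ℚ(E[3])) = 8`, CERT) / `hc3` (`#E(ℚ₃)[3] = 1`). Per row; nothing booked; BSD is not proved by this.
[cite: Kato2004Asterisque, Thm. 14.5 (3) (p. 236) and Prop. 14.16 (2)] [cite: CoatesSujatha2005, §3 Thm. 3.4]
[cite: DeoRaySujatha2023, §3 Thm. 3.9 (b)] [cite: Cremona2006, Table 1 (Cremona label 209088do1)] -/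
theorem missingUpperBoundAt_g209088do1_3_L6
    (hKatoA : Kato2004.rankZero_padicValNat_sha_add_padicValNat_tamagawa_le_of_additive_potGood_of_irreducible_of_fineSelmerDual_fg)
    (hGZK : rank_eq_analyticRank_of_analyticRank_le_one) (hmod : hasEntireLFunction_rat)
    {W : WeierstrassCurve ℚ} [W.IsElliptic] [W.IsGloballyMinimal] (hWeq : W = (⟨0, 0, 0, (-47916), 18037712⟩ : WeierstrassCurve ℚ)) (hr : W.analyticRank = 0)
    (hh : haveI : NumberField ↥(W.divisionField 3) := NumberField.mk
      ¬ 3 ∣ NumberField.classNumber ↥(W.divisionField 3))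
    (hc3 : ∀ v : HeightOneSpectrum (𝓞 ℚ), ((3 : ℕ) : 𝓞 ℚ) ∈ v.asIdeal →
      ∀ x : W.geomPrimaryTorsion 3, 3 • x = 0 → (∀ δ ∈ GreenbergSelmer.decomp v, δ • x = x) → x = 0) :
    MissingUpperBoundAt W 3 := by
  subst hWeq
  haveI : Fact (Nat.Prime 3) := ⟨Nat.prime_three⟩
  exact WildFineSelmerSupersingularCMAnchor.missingUpperBoundAt_wild_of_conjA hKatoA hGZK hmod _ hr classO6_g209088do1_3 irr_g209088do1_3
    (fun κ hκ => conjA_g209088do1_3_L6 rfl hh hc3 κ hκ)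

end Summit.BirchSwinnertonDyer.BirchSwinnertonDyer.Theorems.WildFineSelmerClassNumberL6Records

end
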